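import Summits.MatrixMultiplication.OmegaCensus.STPPVosperSlackTwoCheckersSound2
import Summits.MatrixMultiplication.OmegaCensus.STPPKneserFilter

/-!
# ω-census (abelian STPP census): soundness of the REALISATION stage of the slack-2 checkers (kernel tool)

HONEST FRAMING (pub-omega census; verbatim): lottery ticket; floor = certified bounds/negative ranges.
Census STRUCTURE (seat pub-omega-stpp-1 gen 32, 2026-08-28), family (b2).  `false_of_realisationsDead`: for a two-block STPP family of `ℤ/p` with
`0 ∈ B 1`, value lists `P, Q, R` of (subsets of) `A 0, B 0, C 0`, and lists `Yo`, `Zo` carrying exactly the values of `Y° = C 1 − B 1` and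
`Z° = C 1 − A 1`, the realisation stage cannot be dead: `realisationsDead p #A1 #B1 #C1 P Q R Yo Zo = true` is absurd (the actual block `1`, written as
the candidate filters, passes `isSTPPb` by `isSTPPb_of_isSTPP`).  Shared final step of the case-A and case-C normal-form soundness lemmas.
UNCONDITIONAL; no `decide`.  Nothing here is progress on `ω`.

References: H. Cohn, R. Kleinberg, B. Szegedy, C. Umans, FOCS 2005 (arXiv:math/0511460), Def. 5.1.
-/

open Finset
open scoped Pointwise

namespace Summit.MatrixMultiplication.OmegaCensus.CubeNB.S2

open Literature.Computability.AlgebraicComplexity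
open Summit.MatrixMultiplication.OmegaCensus.STPPKneser
open Summit.MatrixMultiplication.OmegaCensus.CubeNB.Bits

variable {p : ℕ} [hp : Fact p.Prime]

/-- **The realisation stage is sound.**  See the module docstring. [cite: CohnKleinbergSzegedyUmans2005, Def. 5.1] -/
theorem false_of_realisationsDead {A B C : Fin 2 → Finset (ZMod p)} (hS : IsSTPP A B C)
    (hA : ∀ k, (A k).Nonempty) (hB : ∀ k, (B k).Nonempty) (hC : ∀ k, (C k).Nonempty)
    {a₀ b₀ c₀ : ℕ} (ha₀ : #(A 1) = a₀) (hb₀ : #(B 1) = b₀) (hc₀ : #(C 1) = c₀) (hB10 : (0 : ZMod p) ∈ B 1)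
    {P Q R Yo Zo : List ℕ} (hPmem : ∀ v, v ∈ P ↔ ∃ x ∈ A 0, x.val = v) (hQmem : ∀ v, v ∈ Q ↔ ∃ x ∈ B 0, x.val = v)
    (hRmem : ∀ v, v ∈ R → ∃ x ∈ C 0, x.val = v)
    (hYo_mem : ∀ v, v ∈ Yo ↔ ∃ e ∈ DU B C (univ.erase 0), e.val = v) (hYo_nd : Yo.Nodup)
    (hZo_mem : ∀ v, v ∈ Zo ↔ ∃ e ∈ DU A C (univ.erase 0), e.val = v)
    (hreal : realisationsDead p a₀ b₀ c₀ P Q R Yo Zo = true) : False := by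
  have hp0 : 0 < p := hp.out.pos
  have h1 : (univ : Finset (Fin 2)).erase 0 = {1} := by decide
  have hDmem : ∀ cc ∈ C 1, ∀ b ∈ B 1, cc - b ∈ DU B C (univ.erase 0) := fun cc hcc b hb => by
    rw [h1]; exact Finset.mem_biUnion.2 ⟨1, mem_singleton_self 1, mem_D.2 ⟨b, hb, cc, hcc, rfl⟩⟩
  have hDAmem : ∀ cc ∈ C 1, ∀ x ∈ A 1, cc - x ∈ DU A C (univ.erase 0) := fun cc hcc x hx => by
    rw [h1]; exact Finset.mem_biUnion.2 ⟨1, mem_singleton_self 1, mem_D.2 ⟨x, hx, cc, hcc, rfl⟩⟩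
  set C' := Yo.filter fun v => decide (v ∈ (C 1).image ZMod.val) with hC'
  have hC'_mem : ∀ v, v ∈ C' ↔ ∃ cc ∈ C 1, cc.val = v := by
    intro v; rw [hC', List.mem_filter, decide_eq_true_eq, mem_image]
    constructor
    · exact fun h => h.2
    · rintro ⟨cc, hcc, rfl⟩
      exact ⟨(hYo_mem _).2 ⟨cc - 0, hDmem cc hcc 0 hB10, by rw [sub_zero]⟩, cc, hcc, rfl⟩
  have hC'sub : C' ∈ Yo.sublistsLen c₀ := by
    rw [← hc₀, ← card_image_of_injective (C 1) (ZMod.val_injective p)]; exact filter_mem_sublistsLen Yo hYo_nd _ fun v hv => by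
      obtain ⟨cc, hcc, rfl⟩ := mem_image.1 hv
      exact (hYo_mem _).2 ⟨cc - 0, hDmem cc hcc 0 hB10, by rw [sub_zero]⟩
  set candB := (List.range p).filter fun β => C'.all fun cc => tb (maskOf Yo) ((cc + p - β) % p) with hcandB
  have hcandB_mem : ∀ b ∈ B 1, b.val ∈ candB := by
    intro b hb; rw [hcandB, List.mem_filter, List.mem_range, List.all_eq_true]
    refine ⟨b.val_lt, fun cc hcc => ?_⟩
    obtain ⟨c1, hc1, rfl⟩ := (hC'_mem cc).1 hcc
    rw [tb_maskOf, val_sub_eq_mod]; exact (hYo_mem _).2 ⟨c1 - b, hDmem c1 hc1 b hb, rfl⟩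
  have h0cand : (0 : ℕ) ∈ candB := by have := hcandB_mem 0 hB10; rwa [ZMod.val_zero] at this
  set B1 := (candB.filter fun x => !(Nat.beq x 0)).filter fun v => decide (v ∈ (B 1).image ZMod.val) with hB1
  have hB1_mem : ∀ v, v ∈ B1 ↔ ∃ b ∈ B 1, b ≠ 0 ∧ b.val = v := by
    intro v; rw [hB1, List.mem_filter, List.mem_filter, decide_eq_true_eq, mem_image]
    constructor
    · rintro ⟨⟨_, hne⟩, b, hb, rfl⟩
      refine ⟨b, hb, fun hb0 => ?_, rfl⟩
      rw [hb0, ZMod.val_zero] at hne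
      exact Bool.noConfusion hne
    · rintro ⟨b, hb, hne, rfl⟩
      refine ⟨⟨hcandB_mem b hb, ?_⟩, b, hb, rfl⟩
      cases hbeq : Nat.beq b.val 0
      · rfl
      · exact absurd ((ZMod.val_eq_zero b).1 (Nat.eq_of_beq_eq_true hbeq)) hne
  have hB1sub : B1 ∈ (candB.filter fun x => !(Nat.beq x 0)).sublistsLen (b₀ - 1) := by
    have hB1' : B1 = (candB.filter fun x => !(Nat.beq x 0)).filter fun v => decide (v ∈ ((B 1).erase 0).image ZMod.val) := by
      rw [hB1]
      refine List.filter_congr fun v hv => ?_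
      rw [List.mem_filter] at hv
      simp only [decide_eq_decide, mem_image, mem_erase]
      constructor
      · rintro ⟨b, hb, rfl⟩
        refine ⟨b, ⟨fun hb0 => ?_, hb⟩, rfl⟩
        rw [hb0, ZMod.val_zero] at hv; exact Bool.noConfusion hv.2
      · rintro ⟨b, ⟨-, hb⟩, rfl⟩; exact ⟨b, hb, rfl⟩
    rw [hB1', ← hb₀, ← card_erase_of_mem hB10, ← card_image_of_injective ((B 1).erase 0) (ZMod.val_injective p)]
    refine filter_mem_sublistsLen _ (List.nodup_range.filter _ |>.filter _) _ fun v hv => ?_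
    obtain ⟨b, hb, rfl⟩ := mem_image.1 hv
    rw [List.mem_filter]
    refine ⟨hcandB_mem b (mem_erase.1 hb).2, ?_⟩
    cases hbeq : Nat.beq b.val 0
    · rfl
    · exact absurd ((ZMod.val_eq_zero b).1 (Nat.eq_of_beq_eq_true hbeq)) (mem_erase.1 hb).1
  have h0B1_mem : ∀ v, v ∈ (0 :: B1) ↔ ∃ b ∈ B 1, b.val = v := by
    intro v; rw [List.mem_cons, hB1_mem]
    constructor
    · rintro (rfl | ⟨b, hb, -, rfl⟩)
      · exact ⟨0, hB10, ZMod.val_zero⟩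
      · exact ⟨b, hb, rfl⟩
    · rintro ⟨b, hb, rfl⟩
      by_cases hb0 : b = 0
      · left; rw [hb0, ZMod.val_zero]
      · right; exact ⟨b, hb, hb0, rfl⟩
  have hA'cand_mem : ∀ x ∈ A 1, x.val ∈ (List.range p).filter fun α => C'.all fun cc => tb (maskOf Zo) ((cc + p - α) % p) := by
    intro x hx; rw [List.mem_filter, List.mem_range, List.all_eq_true]
    refine ⟨x.val_lt, fun cc hcc => ?_⟩
    obtain ⟨c1, hc1, rfl⟩ := (hC'_mem cc).1 hcc
    rw [tb_maskOf, val_sub_eq_mod]; exact (hZo_mem _).2 ⟨c1 - x, hDAmem c1 hc1 x hx, rfl⟩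
  set A' := ((List.range p).filter fun α => C'.all fun cc => tb (maskOf Zo) ((cc + p - α) % p)).filter
    fun v => decide (v ∈ (A 1).image ZMod.val) with hA'
  have hA'_mem : ∀ v, v ∈ A' ↔ ∃ x ∈ A 1, x.val = v := by
    intro v; rw [hA', List.mem_filter, decide_eq_true_eq, mem_image]
    constructor
    · exact fun h => h.2
    · rintro ⟨x, hx, rfl⟩; exact ⟨hA'cand_mem x hx, x, hx, rfl⟩
  have hA'sub : A' ∈ ((List.range p).filter fun α => C'.all fun cc => tb (maskOf Zo) ((cc + p - α) % p)).sublistsLen a₀ := by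
    rw [← ha₀, ← card_image_of_injective (A 1) (ZMod.val_injective p)]; exact filter_mem_sublistsLen _ (List.nodup_range.filter _) _ fun v hv => by
      obtain ⟨x, hx, rfl⟩ := mem_image.1 hv
      exact hA'cand_mem x hx
  have hD : (C'.flatMap fun cc => (0 :: B1).map fun β => (cc + p - β) % p).Nodup :=
    nodup_flatMap_diff C' (0 :: B1) (C 1) (B 1) (hYo_nd.filter _) (by
        refine List.nodup_cons.2 ⟨fun h0 => ?_, ((List.nodup_range.filter _).filter _).filter _⟩
        obtain ⟨b, _, hne, hb0⟩ := (hB1_mem 0).1 h0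
        exact hne ((ZMod.val_eq_zero b).1 hb0))
      hC'_mem h0B1_mem (fun e he e' he' f hf f' hf' hh => by
        obtain ⟨h1', h2'⟩ := sub_injOn_CB hS hA 1 hf hf' he he' hh; exact ⟨h2', h1'⟩)
  have hDZ : (C'.flatMap fun cc => A'.map fun α => (cc + p - α) % p).Nodup :=
    nodup_flatMap_diff C' A' (C 1) (A 1) (hYo_nd.filter _) ((List.nodup_range.filter _).filter _) hC'_mem hA'_mem
      (fun e he e' he' f hf f' hf' hh => by
        obtain ⟨h1', h2'⟩ := sub_injOn_CA hS hB 1 hf hf' he he' hh; exact ⟨h2', h1'⟩)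
  have hX : (A'.flatMap fun α => (0 :: B1).map fun β => (α + p - β) % p).Nodup :=
    nodup_flatMap_diff A' (0 :: B1) (A 1) (B 1) ((List.nodup_range.filter _).filter _) (by
        refine List.nodup_cons.2 ⟨fun h0 => ?_, ((List.nodup_range.filter _).filter _).filter _⟩
        obtain ⟨b, _, hne, hb0⟩ := (hB1_mem 0).1 h0
        exact hne ((ZMod.val_eq_zero b).1 hb0))
      hA'_mem h0B1_mem (fun e he e' he' f hf f' hf' hh => sub_injOn_AB hS hC 1 he he' hf hf' hh)
  have h0' : (0 : ℕ) ∈ (List.range p).filter fun β => C'.all fun cc => tb (maskOf Yo) ((cc + p - β) % p) := h0cand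
  have hfalse := isSTPPb_false_of_realisationsDead hreal C' B1 A' hC'sub h0' hB1sub hD hA'sub hDZ hX
  have htrue : isSTPPb p [(P, Q, R), (A', 0 :: B1, C')] = true := by
    refine isSTPPb_of_isSTPP hS _ rfl ?_ ?_ ?_
    · intro i v hv
      fin_cases i
      · change v ∈ P at hv
        exact (hPmem v).1 hv
      · change v ∈ A' at hv
        exact (hA'_mem v).1 hv
    · intro i v hv
      fin_cases i
      · change v ∈ Q at hv
        exact (hQmem v).1 hv
      · change v ∈ (0 :: B1) at hv
        exact (h0B1_mem v).1 hv
    · intro i v hv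
      fin_cases i
      · change v ∈ R at hv
        exact hRmem v hv
      · change v ∈ C' at hv
        exact (hC'_mem v).1 hv
  rw [htrue] at hfalse
  exact Bool.noConfusion hfalse

end Summit.MatrixMultiplication.OmegaCensus.CubeNB.S2
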